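import Literature.Analysis.Calculus.HadamardLemma
import HarnessLib

/-!
# The smooth difference quotient in one variable with parameters (Hadamard's lemma, first order)

Topic `Literature/Analysis/Calculus`; a complement to `HadamardLemma.lean` (Part 1: smooth
dependence of interval integrals on parameters; Part 2: the second-order quotient `R f x` in ALL
variables at a critical point). Here: the first-order quotient in ONE distinguished real variable
`s` with smooth dependence on a finite-dimensional parameter `x`,

  `f(x, s) = f(x, 0) + s • Q f (x, s)`,  `Q f (x, s) = ∫₀¹ ∂_s f(x, us) du`,  `Q f (x, 0) = ∂_s f(x, 0)`,

with `Q f` smooth (`C^n` if `f` is `C^{n+1}`): Hadamard's lemma / the fundamental theorem of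
calculus along the segment (Milnor, *Morse theory*, Lemma 2.1: "`f(x) = Σ xᵢ gᵢ(x)` with
`gᵢ(x) = ∫₀¹ ∂f/∂xᵢ(tx) dt`"). Iterating gives the second-order quotient in `s`:
`f(x, s) = f(x, 0) + s • ∂_s f(x, 0) + s² • Q (Q f) (x, s)` (`eq_add_add_sq_smul_slopeQuot₂`).

USE: `h`-uniform bounds by compactness for RESCALED symbols, which are such quotients in the scale
parameter `s = γ^{h/2}` (e.g. `s⁻²[ε(p_F + s²t₁n + st₂τ) - μ]`, Benfatto–Giuliani–Mastropietro 2006,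
Lemma 2.2): the quotient extends smoothly to `s = 0`, so its derivatives are bounded on compact
parameter sets.

Everything is PROVED; the only definition is `slopeQuot`. [folklore]

## References

* J. Milnor, *Morse Theory*, Annals of Math. Studies 51 (1963), Lemma 2.1. [Milnor1963]
* J. Dieudonné, *Foundations of Modern Analysis* (1960), (8.11.2).
-/

noncomputable section

open Set Function MeasureTheory intervalIntegral
open scoped Topology ContDiff

namespace Literature.Analysis.Calculus

variable {E : Type*} [NormedAddCommGroup E] [NormedSpace ℝ E]
  {G : Type*} [NormedAddCommGroup G] [NormedSpace ℝ G]

/-- **The first-order difference quotient in the last variable**: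
`Q f (x, s) = ∫₀¹ ∂_s f (x, u s) du`, where `∂_s f (p) = Df(p)(0, 1)`. [folklore] -/
def slopeQuot (f : E × ℝ → G) (p : E × ℝ) : G :=
  ∫ u in (0 : ℝ)..1, fderiv ℝ f (p.1, u * p.2) (0, 1)

variable [CompleteSpace G]

/-- At `s = 0` the quotient is the partial derivative: `Q f (x, 0) = ∂_s f(x, 0)`. [folklore] -/
theorem slopeQuot_zero (f : E × ℝ → G) (x : E) : slopeQuot f (x, 0) = fderiv ℝ f (x, 0) (0, 1) := by
  simp [slopeQuot, intervalIntegral.integral_const]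

/-- **Hadamard's lemma (first order, one variable with parameters)**:
`f(x, s) = f(x, 0) + s • Q f (x, s)` for `C¹` functions `f`. [folklore] -/
theorem eq_add_smul_slopeQuot {f : E × ℝ → G} {n : WithTop ℕ∞} (hf : ContDiff ℝ n f) (hn : n ≠ 0)
    (x : E) (s : ℝ) : f (x, s) = f (x, 0) + s • slopeQuot f (x, s) := by
  -- `g(u) = f(x, us)` has `g'(u) = s • ∂_s f(x, us)`
  have hdiff : Differentiable ℝ f := hf.differentiable hn
  have hg : ∀ u : ℝ, HasDerivAt (fun u : ℝ => f (x, u * s)) (s • fderiv ℝ f (x, u * s) (0, 1)) u := by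
    intro u
    have h1 : HasDerivAt (fun u : ℝ => ((x, u * s) : E × ℝ)) ((0 : E), s) u := by
      refine HasDerivAt.prodMk (hasDerivAt_const u x) ?_
      simpa using (hasDerivAt_id u).mul_const s
    have h2 := (hdiff (x, u * s)).hasFDerivAt.comp_hasDerivAt u h1
    have h3 : fderiv ℝ f (x, u * s) ((0 : E), s) = s • fderiv ℝ f (x, u * s) (0, 1) := by
      rw [← ContinuousLinearMap.map_smul]
      congr 1
      simp
    rw [h3] at h2
    exact h2
  have hcont : Continuous fun u : ℝ => s • fderiv ℝ f (x, u * s) (0, 1) := by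
    refine continuous_const.smul ?_
    exact ((hf.continuous_fderiv hn).comp (continuous_const.prodMk (continuous_id.mul continuous_const))).clm_apply
      continuous_const
  have hftc := intervalIntegral.integral_eq_sub_of_hasDerivAt (a := 0) (b := 1) (fun u _ => hg u)
    (hcont.intervalIntegrable 0 1)
  simp only [zero_mul, one_mul] at hftc
  show f (x, s) = f (x, 0) + s • ∫ u in (0 : ℝ)..1, fderiv ℝ f (x, u * s) (0, 1)
  rw [← intervalIntegral.integral_smul, hftc]
  abel

variable [FiniteDimensional ℝ E]

/-- **The quotient is smooth**: if `f` is `C^{n+1}` then `Q f` is `Cⁿ` (differentiation under the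
integral sign, `contDiff_intervalIntegral`). [folklore] -/
theorem contDiff_slopeQuot {f : E × ℝ → G} {n : ℕ∞} (hf : ContDiff ℝ ((n + 1 : ℕ∞) : WithTop ℕ∞) f) :
    ContDiff ℝ n (slopeQuot f) := by
  have hF : ContDiff ℝ n (uncurry fun (p : E × ℝ) (u : ℝ) => fderiv ℝ f (p.1, u * p.2) ((0 : E), (1 : ℝ))) := by
    have h1 : ContDiff ℝ n (fderiv ℝ f) := hf.fderiv_right (m := n) (by push_cast; exact le_rfl)
    have h2 : ContDiff ℝ n (fun q : (E × ℝ) × ℝ => ((q.1.1, q.2 * q.1.2) : E × ℝ)) :=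
      (contDiff_fst.comp contDiff_fst).prodMk (contDiff_snd.mul (contDiff_snd.comp contDiff_fst))
    exact (h1.comp h2).clm_apply contDiff_const
  exact contDiff_intervalIntegral hF 0 1

/-- `Q f` is smooth if `f` is. [folklore] -/
theorem contDiff_slopeQuot_infty {f : E × ℝ → G} (hf : ContDiff ℝ ∞ f) : ContDiff ℝ ∞ (slopeQuot f) :=
  contDiff_slopeQuot (n := ⊤) (by rw [top_add]; exact hf)

/-- **The second-order quotient by iteration**:
`f(x, s) = f(x, 0) + s • ∂_s f(x, 0) + s² • Q (Q f) (x, s)` for `C²` functions. [folklore] -/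
theorem eq_add_add_sq_smul_slopeQuot₂ {f : E × ℝ → G} (hf : ContDiff ℝ 2 f) (x : E) (s : ℝ) :
    f (x, s) = f (x, 0) + s • fderiv ℝ f (x, 0) (0, 1) + s ^ 2 • slopeQuot (slopeQuot f) (x, s) := by
  have h1 := eq_add_smul_slopeQuot hf (by norm_num) x s
  have hQ : ContDiff ℝ 1 (slopeQuot f) := contDiff_slopeQuot (n := 1) (by norm_num; exact hf)
  have h2 := eq_add_smul_slopeQuot hQ (by norm_num) x s
  rw [slopeQuot_zero] at h2
  rw [h1, h2, smul_add, smul_smul, sq]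
  abel

end Literature.Analysis.Calculus

end
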